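import Summits.BirchSwinnertonDyer.BirchSwinnertonDyer.Theorems.Rank1ResidualJetStringentMechanism
import Summits.BirchSwinnertonDyer.Rank1Residual.X11b.Three.KolyvaginClassBadPlaceEnd
import HarnessLib

/-!
# T1 JET (cell `bsd-jet`), road K, K-GAP-2 (`h49str`), step (C2): the stringent END FORM for
# Kolyvagin's point — `res_v c(P_n) = δ_v(t)` with `e(t) ∈ B`, from [GZ86 III (3.1)] (`hGZ31`) and the
# strong (α)

HONEST FRAMING (programme file §HONESTY, verbatim): «no tranche here proves BSD; ARM L moves the
LITERAL column of an r ≤ 1 census into the kernel-proved-modulo-named-print column.» THEOREMS ONLY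
(seat `bsd-jet-pv-1`, session g7; `--supports stmt-BirchSwinnertonDyer-14418`, helper); 0 classes
move. WHAT THIS IS. x11b3-p1's END FORM `GrossBadPlace.kolyvaginClass_kolyvaginPoint_mem_selmerLocalKer_of_GZ31`
(Gross 1991 Prop. 6.2 (1) at a bad place for Kolyvagin's `P_n = Σ_{s∈S} s D_n y_n`, inputs `hGZ31` =
[GZ86 III (3.1)] via Gross p. 245 and (α) = Milne I.3.8) concludes the SELMER condition. With the
STRONG (α) (the coboundary witnessed in `B`, step A4 for `B = E⁰(K̄_v)`) the same inputs give the
STRINGENT conclusion of Jetchev 2008 Prop. 4.1/4.9: `res_v c(P_n) = δ_v(t)` for an `E`-rational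
`t ∈ E(K_v)` whose image lies in `B` (step C1 `Stringent.exists_localKummerMap_eq_res_kolyvaginClass`,
fed with: roots in `E′` — x11b3's `KolyvaginRoot.smul_kolyvaginPoint_sub_mem_map`; `P_n ∈ E′` —
`KolyvaginRoot.kolyvaginPoint_mem`; `n′E′_v ⊆ B` — the local clause of `hGZ31`).
References: [cite: Jetchev2008, Prop. 4.1 (pp. 819–821), Prop. 4.9] [cite: GrossLMS1991, Prop. 6.2 (1),
pp. 244–245, §4 (4.1)] [cite: GrossZagier1986, III (3.1)] [cite: McCallumLMS1991, Lemma 4.1, Lemma 4.3]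
[cite: MilneADT2006, Ch. I Prop. 3.8].
-/

set_option autoImplicit false

noncomputable section

open scoped Classical
open scoped AddSubgroup

namespace Summit.BirchSwinnertonDyer.Rank1Residual.JET.Stringent

open WeierstrassCurve NumberField IsDedekindDomain Field
  Literature.NumberTheory.EllipticCurves Literature.NumberTheory.EllipticCurves.KolyvaginCocycle
  Literature.NumberTheory.EllipticCurves.KolyvaginEuler Literature.NumberTheory.GaloisRepresentations
  Summit.BirchSwinnertonDyer.Rank1Residual.X11b.Three.KolyvaginRoot
  Summit.BirchSwinnertonDyer.Rank1Residual.X11b.Three.GrossBadPlace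

universe u

variable {K : Type u} [Field K] [NumberField K] (W : WeierstrassCurve K) [W.IsElliptic] {n : ℤ}
variable {hdiv : ∀ P : geomPoints W, ∃ Q : geomPoints W, n • Q = P}
variable {𝒢 : Type*} [CommGroup 𝒢] {A₀ : Type*} [AddCommGroup A₀] [DistribMulAction 𝒢 A₀]

/-- **Jetchev 2008 Prop. 4.1/4.9 for Kolyvagin's point `P_n`, END FORM with the binder `hGZ31`.**
Setting = x11b3-p1's `kolyvaginClass_kolyvaginPoint_mem_selmerLocalKer_of_GZ31` (`𝒢 = Gal(K_n/K)` on
`A₀ = E(K_n)`, `σ_ℓ`, `L`, `H = G_n`, section `f`, Heegner point `y`, `π`, `j : E(K_n) → E(K̄)`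
equivariant with admissible image, McCallum's class of `jP_n`, a finite place `v` whose inertia
`I_𝔐` fixes `jP_n`, `hGZ31` = [GZ86 III (3.1)] as used by Gross p. 245: `E′ ∋ y` `𝒢`-stable,
`Tr_ℓ y ∈ nE′`, `n′ • (jx)_v ∈ B` for `x ∈ E′`, `n′` prime to `n`), with (α) in the STRONG form:
every `B`-valued continuous crossed homomorphism vanishing on `I_𝔐` is `∂S` with `S ∈ B`.
CONCLUSION: `res_v c(jP_n) = δ_v(t)` for some `t ∈ E(K_v)` with `e(t) ∈ B`. For `B = E⁰(K̄_v)`: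
`loc_v c ∈ δ_v(E₀(K_v)) = H¹_{Kum⁰}`. [cite: Jetchev2008, Prop. 4.1 (pp. 819–821)]
[cite: GrossLMS1991, Prop. 6.2 (1), pp. 244–245] [cite: GrossZagier1986, III (3.1)]
[cite: MilneADT2006, Ch. I Prop. 3.8] -/
theorem exists_localKummerMap_eq_res_kolyvaginClass_kolyvaginPoint_of_GZ31 (hn : n ≠ 0)
    {σ : ℕ → 𝒢} {L : Finset ℕ} {H : Subgroup 𝒢} [Fintype (𝒢 ⧸ H)] {f : 𝒢 ⧸ H → 𝒢}
    (hf : ∀ q, (f q : 𝒢 ⧸ H) = q) (hgen : H ≤ Subgroup.closure (σ '' (L : Set ℕ)))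
    (hord : ∀ ℓ ∈ L, σ ℓ ^ (ℓ + 1) = 1) (hdvd : ∀ ℓ ∈ L, n ∣ ((ℓ + 1 : ℕ) : ℤ)) {y : A₀}
    (π : absoluteGaloisGroup K →* 𝒢) (j : A₀ →+ geomPoints W)
    (hj : ∀ (g : absoluteGaloisGroup K) (a : A₀), j (π g • a) = g • j a)
    (hA : IsAdmissible (absoluteGaloisGroup K) j.range n)
    (hP : j (kolyvaginPoint σ L f y) ∈ invPoints (absoluteGaloisGroup K) j.range n)
    (v : HeightOneSpectrum (𝓞 K)) {𝔐 : Ideal (v.localAbsIntegers)}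
    (hI : ∀ τ ∈ 𝔐.inertia (absoluteGaloisGroup (v.adicCompletion K)),
      resGal (K := K) (v.adicCompletion K) τ • j (kolyvaginPoint σ L f y) =
        j (kolyvaginPoint σ L f y))
    {E' : AddSubgroup A₀} (B : AddSubgroup (localPoints W (v.adicCompletion K))) {n' : ℤ}
    (hGZ31 : (∀ (γ : 𝒢), ∀ e ∈ E', γ • e ∈ E') ∧ y ∈ E' ∧
      (∀ ℓ ∈ L, grAct A₀ (traceElt (σ ℓ) ℓ) y ∈ E'.map (zsmulAddGroupHom n : A₀ →+ A₀)) ∧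
      ∀ x ∈ E', n' • pointsMap W (v.adicCompletion K) (j x) ∈ B)
    (hcop : IsCoprime n n')
    (hcob : ∀ c : contOneCocycles (discreteTopRep (absoluteGaloisGroup (v.adicCompletion K))
        (localPoints W (v.adicCompletion K))),
      (∀ τ, c.1 τ ∈ B) → (∀ τ ∈ 𝔐.inertia (absoluteGaloisGroup (v.adicCompletion K)), c.1 τ = 0) →
        ∃ S ∈ B, ∀ τ, c.1 τ = τ • S - S) :
    ∃ t : (W.baseChange (v.adicCompletion K)).toAffine.Point,
      W.baseChangeGeomPointsEquiv (v.adicCompletion K)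
          (toGeomPoints (W.baseChange (v.adicCompletion K)) t) ∈ B ∧
        W.localKummerMap (v.adicCompletion K) hn t =
          galoisCohomology.res (W.torsionGaloisModule n) (v.adicCompletion K) 1
            (kolyvaginClass W n hdiv hA (j (kolyvaginPoint σ L f y)) hP) := by
  haveI : CharZero (v.adicCompletion K) :=
    charZero_of_injective_algebraMap (algebraMap K _).injective
  obtain ⟨hE, hy, htr, hloc⟩ := hGZ31
  -- integrality of the roots inside `E′` (Gross p. 245), and `P_n ∈ E′`
  have hroot : ∀ γ : 𝒢, γ • kolyvaginPoint σ L f y - kolyvaginPoint σ L f y ∈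
      E'.map (zsmulAddGroupHom n : A₀ →+ A₀) :=
    smul_kolyvaginPoint_sub_mem_map hE hf hgen hord hdvd hy htr
  have hPE : kolyvaginPoint σ L f y ∈ E' := kolyvaginPoint_mem hE f hy
  refine exists_localKummerMap_eq_res_kolyvaginClass W (v.adicCompletion K) hn hA hP hI B hcop
    (hloc _ hPE) (fun τ ↦ ?_) hcob
  -- the value of McCallum's cocycle at `τ` is the image of a point of `E′`
  obtain ⟨x, hx, hxe⟩ : rootIn j.range n (resGal (K := K) (v.adicCompletion K) τ •
      j (kolyvaginPoint σ L f y) - j (kolyvaginPoint σ L f y)) ∈ E'.map j :=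
    rootIn_smul_sub_mem_map_of_equivariant π j hj hA hroot _
  rw [← hxe]
  exact hloc x hx

end Summit.BirchSwinnertonDyer.Rank1Residual.JET.Stringent

end
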